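import Summits.QuantumAdvantage.QuantumAdvantage.Theorems.LinnikCubicClassGroupsPureCubicClassGroupFBQP
import HarnessLib

/-!
# The quantum half from the `n = 3` slice: `CubicEscape →` (the low bits of `h(ℚ(∛m))` are an FBQP function)

Topic `Summits/QuantumAdvantage/QuantumAdvantage/Theorems`, route `LinnikCubicClassGroups`; cell B2b-1 (linnik-cubic),
PART B. HONEST FRAMING: the value of this file is a THEOREM (a kernel-checked strengthening of the proved crux
`PureCubicClassGroupFBQP`, stmt-QuantumAdvantage-11544) — NOT summit progress.

The landed proof `PureCubicClassGroupFBQP_proof : DegreeOnePrimesEscape → (∃ f ∈ FBQP, …)` consumes its hypothesis only at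
degree `3` (`stub_generation`: `obtain ⟨C₃, hC₃⟩ := hEsc 3`; cdisprove `route_needs_only_three`). Here the same composition is
run from the `n = 3` slice ALONE — `CubicEscape`, the body of `DegreeOnePrimesEscape` at `n = 3`, taken as an explicit
hypothesis (no new definition):

* `generation_of_cubicEscape` — `stub_generation` verbatim with `hEsc 3` replaced by the slice;
* `fbqp_of_cubicEscape` — **`CubicEscape → ∃ f ∈ FBQP, |f x| = 2|x|+8, f x = the low bits of h(K)` for every cubic
  `K ∋ ∛(decodeNat x)`**, by the line's composition `crux_conclusion_of_canonical ∘ stub_assembly ∘ …` exactly as in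
  `PureCubicClassGroupFBQP_of_parts`.

With `CubicEscape` proved (sibling file `…CubicEscapeProof.lean`, from the log-free zero density at degree `3`, the
residue bound, the per-character deficit and the lower prime ideal theorem) this yields the UNCONDITIONAL theorem.
-/

namespace Summit.QuantumAdvantage.QuantumAdvantage.Theorems.LinnikCubicClassGroups

open scoped NumberField nonZeroDivisors
open NumberField
open Literature.Computability.Cryptography
open Computability (decodeNat)

/-- **GENERATION from the `n = 3` slice** (`stub_generation` of line `arakelov-giant-step-cycle`, verbatim, with the route
hypothesis `DegreeOnePrimesEscape` replaced by its `n = 3` slice): for every cubic `K ∋ ∛m` (`m` a non-cube) and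
`X ≥ (27 m²)^C` — (i) the good primes `p ≤ X`, `p ∤ 3m` number `≥ X/(4(⌊log₂ X⌋+1))`; (ii) for `T ≥ 600(⌊log₂ X⌋+1)²`
all but a fraction `≤ 1/8` of the `T`-tuples of good primes have degree-one primes above them whose classes generate
`Cl(𝓞 K)`. -/
theorem generation_of_cubicEscape :
    (∀ m : ℕ, (∀ r : ℕ, r ^ 3 ≠ m) →
      (∃ (K : Type) (_ : Field K) (_ : NumberField K), Module.finrank ℚ K = 3 ∧ ∃ α : K, α ^ 3 = (m : K)) ∧
      ∀ (K : Type) [Field K] [NumberField K], Module.finrank ℚ K = 3 → (∃ α : K, α ^ 3 = (m : K)) →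
        (∀ F : IntermediateField ℚ K, Module.finrank ℚ F ≠ 2) ∧
        |NumberField.discr K| ≤ 27 * (m : ℤ) ^ 2 ∧
        NumberField.classNumber K ≤ (27 * m ^ 2) ^ 10 ∧
        ∀ p : ℕ, p.Prime → {P : Ideal (𝓞 K) | P.IsPrime ∧ Ideal.absNorm P = p}.ncard ≤ 3) →
    (∃ C : ℕ, ∀ (K : Type) [Field K] [NumberField K], Module.finrank ℚ K = 3 →
      (∀ F : IntermediateField ℚ K, Module.finrank ℚ F ≠ 2) → ∀ x : ℕ, |NumberField.discr K| ^ C ≤ (x : ℤ) →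
      ∀ M : Subgroup (ClassGroup (NumberField.RingOfIntegers K)), M ≠ ⊤ →
        Nat.primeCounting x ≤ 8 * Set.ncard {P : Ideal (NumberField.RingOfIntegers K) | P.IsPrime ∧
          (Ideal.absNorm P).Prime ∧ Ideal.absNorm P ≤ x ∧
          ∃ hP : P ∈ nonZeroDivisors (Ideal (NumberField.RingOfIntegers K)), ClassGroup.mk0 ⟨P, hP⟩ ∉ M}) →
    ∃ C : ℕ, ∀ (K : Type) [Field K] [NumberField K],
    Module.finrank ℚ K = 3 → ∀ m : ℕ, (∀ r : ℕ, r ^ 3 ≠ m) → (∃ α : K, α ^ 3 = (m : K)) →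
    ∀ X : ℕ, (27 * m ^ 2) ^ C ≤ X →
      X ≤ 4 * (Nat.log 2 X + 1) * Nat.card {p : ℕ // p.Prime ∧ p ≤ X ∧ ¬ p ∣ 3 * m} ∧
      ∀ T : ℕ, 600 * (Nat.log 2 X + 1) ^ 2 ≤ T →
        8 * Nat.card {v : Fin T → {p : ℕ // p.Prime ∧ p ≤ X ∧ ¬ p ∣ 3 * m} //
            Subgroup.closure {c : ClassGroup (𝓞 K) | ∃ i : Fin T, ∃ P : Ideal (𝓞 K),
              ∃ hP : P ∈ nonZeroDivisors (Ideal (𝓞 K)),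
                P.IsPrime ∧ Ideal.absNorm P = (v i : ℕ) ∧ c = ClassGroup.mk0 ⟨P, hP⟩} ≠ ⊤} ≤
          Nat.card {p : ℕ // p.Prime ∧ p ≤ X ∧ ¬ p ∣ 3 * m} ^ T := by
  intro hfacts hEsc
  obtain ⟨C₃, hC₃⟩ := hEsc
  refine ⟨max C₃ 4, ?_⟩
  intro K _ _ hdeg m hm hα X hX
  obtain ⟨hnoquad, hdisc, hclass, hfib⟩ := (hfacts m hm).2 K hdeg hα
  -- `m ≥ 2` since `0` and `1` are cubes
  have hm2 : 2 ≤ m := by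
    rcases Nat.lt_or_ge m 2 with h | h
    · interval_cases m
      · exact absurd rfl (hm 0)
      · exact absurd rfl (hm 1)
    · exact h
  have hm0 : m ≠ 0 := by omega
  -- the base `27 m² ≥ 64` and the logarithms
  have hB64 : 2 ^ 6 ≤ 27 * m ^ 2 := by nlinarith [hm2]
  have hB0 : 27 * m ^ 2 ≠ 0 := by positivity
  have hC4 : 4 ≤ max C₃ 4 := le_max_right _ _
  have hBX : 27 * m ^ 2 ≤ X :=
    calc 27 * m ^ 2 = (27 * m ^ 2) ^ 1 := (pow_one _).symm
      _ ≤ (27 * m ^ 2) ^ max C₃ 4 := Nat.pow_le_pow_right (by omega) (by omega)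
      _ ≤ X := hX
  have hX0 : X ≠ 0 := by omega
  have hb6 : 6 ≤ Nat.log 2 (27 * m ^ 2) := Nat.le_log_of_pow_le one_lt_two hB64
  have hL6 : 6 ≤ Nat.log 2 X := Nat.le_log_of_pow_le one_lt_two (hB64.trans hBX)
  have hLb : max C₃ 4 * Nat.log 2 (27 * m ^ 2) ≤ Nat.log 2 X := by
    refine Nat.le_log_of_pow_le one_lt_two ?_
    calc 2 ^ (max C₃ 4 * Nat.log 2 (27 * m ^ 2)) = (2 ^ Nat.log 2 (27 * m ^ 2)) ^ max C₃ 4 := by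
          rw [mul_comm, pow_mul]
      _ ≤ (27 * m ^ 2) ^ max C₃ 4 := Nat.pow_le_pow_left (Nat.pow_log_le_self 2 hB0) _
      _ ≤ X := hX
  -- Chebyshev: `π(X) ≥ 1800 m`
  have hcheb := le_log_succ_mul_primeCounting_succ X
  have hπ : 1800 * m ≤ Nat.primeCounting X := by
    have h1 : (Nat.log 2 X + 1) * (Nat.log 2 X + 1) ≤ X :=
      (succ_sq_le_two_pow hL6).trans (Nat.pow_log_le_self 2 hX0)
    have h2 : (1800 * m + 1) * (1800 * m + 1) ≤ X := by
      have h8 : 8 * m ≤ m ^ 4 :=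
        calc 8 * m = 2 ^ 3 * m := by norm_num
          _ ≤ m ^ 3 * m := Nat.mul_le_mul_right _ (Nat.pow_le_pow_left hm2 3)
          _ = m ^ 4 := by ring
      have h3 : 1800 * m + 1 ≤ (27 * m ^ 2) ^ 2 := by nlinarith [h8, hm2]
      calc (1800 * m + 1) * (1800 * m + 1) ≤ (27 * m ^ 2) ^ 2 * (27 * m ^ 2) ^ 2 :=
            Nat.mul_le_mul h3 h3
        _ = (27 * m ^ 2) ^ 4 := by ring
        _ ≤ (27 * m ^ 2) ^ max C₃ 4 := Nat.pow_le_pow_right (by omega) hC4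
        _ ≤ X := hX
    have key : (Nat.log 2 X + 1) * (1800 * m + 1) ≤
        (Nat.log 2 X + 1) * (Nat.primeCounting X + 1) := by
      rcases le_total (Nat.log 2 X + 1) (1800 * m + 1) with h | h
      · exact ((Nat.mul_le_mul_right _ h).trans h2).trans hcheb
      · exact ((Nat.mul_le_mul_left _ h).trans h1).trans hcheb
    have := Nat.le_of_mul_le_mul_left key (Nat.succ_pos _)
    omega
  obtain ⟨hNle, hNge⟩ := card_goodPrimes X m hm0
  refine ⟨?_, fun T hT => ?_⟩
  · -- (i) density
    have h4 : Nat.primeCounting X + 1 ≤ 4 * Nat.card {p : ℕ // p.Prime ∧ p ≤ X ∧ ¬ p ∣ 3 * m} := by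
      omega
    calc X ≤ (Nat.log 2 X + 1) * (Nat.primeCounting X + 1) := hcheb
      _ ≤ (Nat.log 2 X + 1) * (4 * Nat.card {p : ℕ // p.Prime ∧ p ≤ X ∧ ¬ p ∣ 3 * m}) :=
          Nat.mul_le_mul_left _ h4
      _ = _ := by ring
  -- (ii) generation
  haveI : Finite {p : ℕ // p.Prime ∧ p ≤ X ∧ ¬ p ∣ 3 * m} :=
    Finite.of_injective (fun p => (⟨p.1, Nat.lt_succ_of_le p.2.2.1⟩ : Fin (X + 1)))
      fun a b h => Subtype.ext (Fin.val_eq_of_eq h)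
  have hdiscX : |NumberField.discr K| ^ C₃ ≤ (X : ℤ) :=
    calc |NumberField.discr K| ^ C₃ ≤ (27 * (m : ℤ) ^ 2) ^ C₃ :=
          pow_le_pow_left₀ (abs_nonneg _) hdisc C₃
      _ = (((27 * m ^ 2) ^ C₃ : ℕ) : ℤ) := by push_cast; ring
      _ ≤ (((27 * m ^ 2) ^ max C₃ 4 : ℕ) : ℤ) := by
          exact_mod_cast Nat.pow_le_pow_right (by omega) (le_max_left _ _)
      _ ≤ X := by exact_mod_cast hX
  -- escape: for a proper `H`, at most `24N/25` good primes have all degree-one classes in `H`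
  have hD : ∀ H : Subgroup (ClassGroup (𝓞 K)), H ≠ ⊤ →
      Nat.card {p : {p : ℕ // p.Prime ∧ p ≤ X ∧ ¬ p ∣ 3 * m} //
        {c : ClassGroup (𝓞 K) | ∃ P : Ideal (𝓞 K), ∃ hP : P ∈ nonZeroDivisors (Ideal (𝓞 K)),
          P.IsPrime ∧ Ideal.absNorm P = (p : ℕ) ∧ c = ClassGroup.mk0 ⟨P, hP⟩} ⊆
          (H : Set (ClassGroup (𝓞 K)))} ≤
      24 * Nat.card {p : ℕ // p.Prime ∧ p ≤ X ∧ ¬ p ∣ 3 * m} / 25 := by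
    intro H hH
    classical
    have hsplit := (Nat.card_sum ..).symm.trans (Nat.card_congr (Equiv.sumCompl
      fun p : {p : ℕ // p.Prime ∧ p ≤ X ∧ ¬ p ∣ 3 * m} =>
        {c : ClassGroup (𝓞 K) | ∃ P : Ideal (𝓞 K), ∃ hP : P ∈ nonZeroDivisors (Ideal (𝓞 K)),
          P.IsPrime ∧ Ideal.absNorm P = (p : ℕ) ∧ c = ClassGroup.mk0 ⟨P, hP⟩} ⊆
          (H : Set (ClassGroup (𝓞 K)))))
    have he : Nat.card {p : {p : ℕ // p.Prime ∧ p ≤ X ∧ ¬ p ∣ 3 * m} //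
        ¬ ({c : ClassGroup (𝓞 K) | ∃ P : Ideal (𝓞 K), ∃ hP : P ∈ nonZeroDivisors (Ideal (𝓞 K)),
          P.IsPrime ∧ Ideal.absNorm P = (p : ℕ) ∧ c = ClassGroup.mk0 ⟨P, hP⟩} ⊆
          (H : Set (ClassGroup (𝓞 K))))} =
        Nat.card {p : {p : ℕ // p.Prime ∧ p ≤ X ∧ ¬ p ∣ 3 * m} //
          ∃ P : Ideal (𝓞 K), ∃ hP : P ∈ nonZeroDivisors (Ideal (𝓞 K)),
            P.IsPrime ∧ Ideal.absNorm P = (p : ℕ) ∧ ClassGroup.mk0 ⟨P, hP⟩ ∉ H} := by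
      refine Nat.card_congr (Equiv.subtypeEquivRight fun p => ⟨fun h => ?_, ?_⟩)
      · by_contra h'
        exact h fun c ⟨P, hP, h1, h2, h3⟩ => h3 ▸ by_contra fun hc => h' ⟨P, hP, h1, h2, hc⟩
      · rintro ⟨P, hP, h1, h2, h3⟩ h
        exact h3 (h ⟨P, hP, h1, h2, rfl⟩)
    have hcomb : Nat.primeCounting X ≤
        24 * Nat.card {p : {p : ℕ // p.Prime ∧ p ≤ X ∧ ¬ p ∣ 3 * m} //
          ∃ P : Ideal (𝓞 K), ∃ hP : P ∈ nonZeroDivisors (Ideal (𝓞 K)),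
            P.IsPrime ∧ Ideal.absNorm P = (p : ℕ) ∧ ClassGroup.mk0 ⟨P, hP⟩ ∉ H} + 72 * m :=
      calc Nat.primeCounting X ≤ _ := hC₃ K hdeg hnoquad X hdiscX H hH
        _ ≤ 8 * (3 * (_ + 3 * m)) := Nat.mul_le_mul_left _ (ncard_escapeSet_le K X m hm0 hfib H)
        _ = _ := by ring
    rw [Nat.le_div_iff_mul_le (by norm_num)]
    omega
  have hunion := card_closure_ne_top_le T
    (24 * Nat.card {p : ℕ // p.Prime ∧ p ≤ X ∧ ¬ p ∣ 3 * m} / 25)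
    (fun p : {p : ℕ // p.Prime ∧ p ≤ X ∧ ¬ p ∣ 3 * m} =>
      {c : ClassGroup (𝓞 K) | ∃ P : Ideal (𝓞 K), ∃ hP : P ∈ nonZeroDivisors (Ideal (𝓞 K)),
        P.IsPrime ∧ Ideal.absNorm P = (p : ℕ) ∧ c = ClassGroup.mk0 ⟨P, hP⟩})
    (fun v => {c : ClassGroup (𝓞 K) | ∃ i : Fin T, ∃ P : Ideal (𝓞 K),
      ∃ hP : P ∈ nonZeroDivisors (Ideal (𝓞 K)),
        P.IsPrime ∧ Ideal.absNorm P = (v i : ℕ) ∧ c = ClassGroup.mk0 ⟨P, hP⟩})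
    (fun w t => by
      rintro c ⟨P, hP, h1, h2, h3⟩
      exact ⟨t, P, hP, h1, h2, h3⟩) hD
  -- the subgroup count and the final arithmetic
  have hsub := Literature.Computability.Cryptography.Hallgren2005.card_subgroup_le
    (G := ClassGroup (𝓞 K))
  have hh : Nat.card (ClassGroup (𝓞 K)) ≤ (27 * m ^ 2) ^ 10 := by
    rw [Nat.card_eq_fintype_card]; exact hclass
  have hexp := exponent_le (T := T) hB0 hh
    ((Nat.mul_le_mul_right _ (by omega : 3 ≤ max C₃ 4)).trans hLb) (by omega) hT
  have hfin := eight_mul_pow_log_mul_pow_le _ T hexp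
  refine Nat.le_of_mul_le_mul_left ?_ (pow_pos (by norm_num : 0 < 25) T)
  calc 25 ^ T * (8 * _) ≤ 25 ^ T * (8 * (Nat.card (Subgroup (ClassGroup (𝓞 K))) *
        (24 * Nat.card {p : ℕ // p.Prime ∧ p ≤ X ∧ ¬ p ∣ 3 * m} / 25) ^ T)) :=
        Nat.mul_le_mul_left _ (Nat.mul_le_mul_left _ hunion)
    _ = 8 * Nat.card (Subgroup (ClassGroup (𝓞 K))) *
        (25 * (24 * Nat.card {p : ℕ // p.Prime ∧ p ≤ X ∧ ¬ p ∣ 3 * m} / 25)) ^ T := by ring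
    _ ≤ 8 * (Nat.card (ClassGroup (𝓞 K)) + 1) ^ Nat.log 2 (Nat.card (ClassGroup (𝓞 K))) *
        (24 * Nat.card {p : ℕ // p.Prime ∧ p ≤ X ∧ ¬ p ∣ 3 * m}) ^ T :=
        Nat.mul_le_mul (Nat.mul_le_mul_left _ hsub) (Nat.pow_le_pow_left (Nat.mul_div_le _ _) T)
    _ = 8 * (Nat.card (ClassGroup (𝓞 K)) + 1) ^ Nat.log 2 (Nat.card (ClassGroup (𝓞 K))) *
        24 ^ T * Nat.card {p : ℕ // p.Prime ∧ p ≤ X ∧ ¬ p ∣ 3 * m} ^ T := by ring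
    _ ≤ 25 ^ T * Nat.card {p : ℕ // p.Prime ∧ p ≤ X ∧ ¬ p ∣ 3 * m} ^ T :=
        Nat.mul_le_mul_right _ hfin


/-- **The quantum half from `CubicEscape`**: if the escape count holds for cubic fields (the `n = 3` slice of
`DegreeOnePrimesEscape`), then there is `f ∈ FBQP` with `|f x| = 2|x|+8` and `f x =` the low `2|x|+8` bits of `h(K)` for every
cubic number field `K` containing a cube root of the non-cube `decodeNat x` — the composition of line `arakelov-giant-step-cycle`
(`PureCubicClassGroupFBQP_of_parts`) run from `generation_of_cubicEscape`. -/
theorem fbqp_of_cubicEscape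
    (hC : ∃ C : ℕ, ∀ (K : Type) [Field K] [NumberField K], Module.finrank ℚ K = 3 →
      (∀ F : IntermediateField ℚ K, Module.finrank ℚ F ≠ 2) → ∀ x : ℕ, |NumberField.discr K| ^ C ≤ (x : ℤ) →
      ∀ M : Subgroup (ClassGroup (NumberField.RingOfIntegers K)), M ≠ ⊤ →
        Nat.primeCounting x ≤ 8 * Set.ncard {P : Ideal (NumberField.RingOfIntegers K) | P.IsPrime ∧
          (Ideal.absNorm P).Prime ∧ Ideal.absNorm P ≤ x ∧
          ∃ hP : P ∈ nonZeroDivisors (Ideal (NumberField.RingOfIntegers K)), ClassGroup.mk0 ⟨P, hP⟩ ∉ M}) :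
    ∃ f : List Bool → List Bool, f ∈ Literature.Computability.Cryptography.FBQP ∧
      (∀ x, (f x).length = 2 * x.length + 8) ∧
      ∀ (x : List Bool) (K : Type) [Field K] [NumberField K], Module.finrank ℚ K = 3 →
        (∀ r : ℕ, r ^ 3 ≠ Computability.decodeNat x) → (∃ α : K, α ^ 3 = (Computability.decodeNat x : K)) →
        f x = List.ofFn (fun i : Fin (2 * x.length + 8) => (NumberField.classNumber K).testBit i.val) := by
  have hcount := generation_of_cubicEscape stub_cubicFieldFacts hC
  have hcore := subgroupOrder_of_parts claimTableSem_holds stub_classSamplingLaw stub_relationLatticeIndex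
    (stub_coreOrderCanonical stub_admissibleFields) regulator_of_parts
  exact crux_conclusion_of_canonical (stub_assembly (stub_assemblySampler stub_assemblySamplerAcc) hcount hcore)

end Summit.QuantumAdvantage.QuantumAdvantage.Theorems.LinnikCubicClassGroups
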